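import Summits.BirchSwinnertonDyer.Rank1Residual.Additive.PotMultRatMainConjLowerBound
import Summits.BirchSwinnertonDyer.Rank1Residual.Additive.ChiBranchRatLowerDvdMultOdd
import Summits.BirchSwinnertonDyer.Rank1Residual.Additive.CensusQ6UnitCoeffCertificate
import Summits.BirchSwinnertonDyer.Rank1Residual.Additive.GordChiBranchKatoComponent
import Summits.BirchSwinnertonDyer.Rank1Residual.Additive.SemistableTwistTowerThree
import Summits.BirchSwinnertonDyer.Rank1Residual.AdditivePotMult.PotMultChiBranchPrime
import Summits.BirchSwinnertonDyer.Rank1Residual.AdditivePotMult.CyclotomicThreeOfHalf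
import Summits.BirchSwinnertonDyer.Rank1Residual.GaloisImage.JWitnessTowerSurjectivity
import Literature.NumberTheory.EllipticCurves.PAdicBSDSkinnerUrbanProofs
import Literature.NumberTheory.EllipticCurves.CyclotomicIwasawaMainTheoremIrreducibleBaseChangeProofs
import Literature.NumberTheory.EllipticCurves.Wuthrich2014.ThreeAdicImageSupersingularProofs
import HarnessLib

/-!
# The located gap of T-N10R on the (M) locus in its NATIVE `Λ ⊗ ℚ_p` shape, EVEN branch
# (`p ≡ 1 (mod 4)`): the one-sided RATIONAL Skinner-type containment
# `char_Λ X ⊆ (L_p⁺(f♭, a_p, ω^{(p−1)/2}))` for the MULTIPLICATIVE twist — typed; Kato's printed half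
# upgrades it to `ChiBranchRatCharEqMultAt`; ends at `p ≡ 1 (mod 4)`
# (cell `b2b-bsdres`, team n1011, seat n1011-p06 gen 2, OWNERS row T-N10R, phase 4, (M)-even twin)

HONEST FRAMING (cell `b2b-bsdres`, run/shared/lean/b2b/bsd-rank1-residual/, verbatim in every
file): the goal of the cell is to DELETE the COMBINATION-SHAPED residual classes of the
Birch–Swinnerton-Dyer formula for ALL analytic-rank `≤ 1` elliptic curves over `ℚ` — "full BSD
formula for every rank `≤ 1` curve in class `C`" assembled STRICTLY from published theorems — so
that the rank-`≤ 1` remainder becomes exactly the CONSTRUCTION-SHAPED classes, which are TYPED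
(missing-input `Prop`s), NOT attempted. This is not "finishing BSD". Team n1011 (X4 ∧ `p = 3` / the
additive block, §I items N10 / N11): research routes; prove what is provable now; no claim beyond
the stated classes; X4(M) stays CONSTRUCTION-SHAPED; labels / census / located gap UNCHANGED; nothing
is booked. ONE definition (a typed input, nothing asserted) and theorems; no new named fact (the
Literature inputs are the explicit binders `hKato` = the Kato/Wuthrich half-eigenspace reading,
`hDelX`, `hDel`).

## What and why

(M)-EVEN twin of `ChiBranchRatLowerDvdMultOdd.lean` (same seat; completes the phase-4 matrix). On the
(M) locus at a prime `p ≡ 1 (mod 4)` (`E = E♭ ⊗ χ_p`, `E♭` MULTIPLICATIVE at `p`; Q6 register: 18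
window rows (M)@5, sweep rows at 5, 13, 17, 29, …) row T-N10R's typed input is the rational EQUALITY
`ChiBranchRatCharEqMultAt W p` (`PotMultRatMainConjLowerBound.lean`, p251037) on the EVEN branch of the
one-term measure `padicLFunctionPlusBranchMult f♭ a_p ((p−1)/2)`, Néron normalisation `ϖ·Ω_V = Ω⁺_f`.
ONE containment is IN PRINT (the semistable big-image half-eigenspace reading
`Wuthrich2014.kato_halfEigenCharIdeal_dvd_cyclotomicPrime_of_surjective`, multiplicative disjuncts,
even parity), transported to `X(W/ℚ_∞)` by `isTorsion_and_exists_map_eq_of_halfTail` (the (M)-odd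
file's core keeping the series). The OTHER containment is the located gap in the native `Λ ⊗ ℚ_p`
currency of a Skinner-type theorem. So:

* §0 TYPED: `ChiBranchRatLowerDvdMultAt W p`; nothing asserted; weaker than `ChiBranchRatCharEqMultAt`.
* §1 KERNEL: Kato's half on `X(W/ℚ_∞)`, even branch: `ι g₁ = u · ϖ · L_p⁺(f♭, a_p, ω^{(p−1)/2}, T)`.
* §2 KERNEL (the split): §1 + §0 + the tower of `W` ⟹ `ChiBranchRatCharEqMultAt W p`.
* §3 ENDS on X4(M) ∧ surj(p), `p ≡ 1 (mod 4)` (tower certificate-free: `ClassX4M.towerSurj_of_surj`):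
  `ChiBranchRatLowerDvdMultAt W p` + ONE unit coefficient (`MultBranchUnitCoeffCert`, or census-ctyper1's
  record `CensusQ6.MultFirstUnitIndexAt W p n₀`) ⟹ (p251037) the LOWER half and `BSD(E,p)` (Pal `hPal`
  for the even Birch identity; `hL20` discharged by the tree's `lemma20_…_holds`).

X4(M) stays CONSTRUCTION-SHAPED; located gap unchanged in substance; nothing booked; no label change.

References: Skinner–Urban, Invent. Math. 195 (2014) Cor. 3.6.2, Thm. 3.6.4 [SkinnerUrban2014];
Kato, Astérisque 295 (2004) Thm. 17.4 (3) [Kato2004Asterisque]; Pal, Proc. AMS (2012) Thm. 3.2 [Pal2012]; Wuthrich, J. London Math. Soc. 90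
(2014) Thm. 3, Cor. 19, Lemma 20 [Wuthrich2014]; Mazur–Tate–Teitelbaum, Invent. Math. 84 (1986)
§I.10–I.14 [MazurTateTeitelbaum1986Invent]; Greenberg, LNM 1716 §5 [GreenbergLNM1716]; Delbourgo,
Compositio Math. 113 (1998) Prop. 4 [Delbourgo1998]; Miller, LMS JCM 14 (2011) Def. 1.1 [Miller2011LMS].
-/

noncomputable section

open scoped Classical MatrixGroups ModularForm NumberField

open CongruenceSubgroup WeierstrassCurve NumberField Literature.NumberTheory.EllipticCurves
  Literature.NumberTheory.EllipticCurves.ModularForms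
  Literature.NumberTheory.EllipticCurves.Rank1Residual
  Literature.NumberTheory.EllipticCurves.Rank1Residual.Typed
  Literature.NumberTheory.GaloisRepresentations
  IsDedekindDomain

namespace Summit.BirchSwinnertonDyer.Rank1Residual.Additive

open AdditivePotMult

/-! ### §0 The typed input: the one-sided RATIONAL containment on the even branch, multiplicative twist -/

/-- **The Skinner direction of the `ω^{(p−1)/2}`-branch (EVEN) cyclotomic main conjecture of the
MULTIPLICATIVE twist, RATIONALLY, TYPED** (`p ≡ 1 (mod 4)`). For the additive curve
`E = W` (globally minimal): whenever `W = C • V^{(p)}` for a globally minimal `V = E♭` multiplicative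
at `p` with newform `f` and `a_p(f) = ap` (`= ±1`), `κ`/`γ` the cyclotomic `ℤ_p`-extension with a
generator matching the cyclotomic variable, `D` a `Λ`-dual datum of `Sel_{p^∞}(W/ℚ_∞)` and
`ϖ · Ω_V = Ω⁺_f`, EVERY `g ∈ char_Λ X(W/ℚ_∞)` has `p^m · g ∈ (G)` for some `G ∈ Λ`, `m n ∈ ℕ`, with
`ι G = p^n · ϖ · L_p⁺(f, ap, ω^{(p−1)/2}, T)` (the even branch of the ONE-term measure,
`padicLFunctionPlusBranchMult`, MTT §I.10/§I.13) — `char_Λ X ⊆ (ϖ L_p⁺)·(Λ ⊗ ℚ_p)`, the SHAPE of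
Skinner–Urban 2014 Cor. 3.6.2 / Skinner 2016 Thm. A on the `χ_p`-branch (printed for the trivial
branch only). CURRENCY vs. T-N10-low (lead R5-24): n1011-p10's `QuadraticBranchLowerDivisibilityAt V p`
(`Additive/QuadraticBranchLower.lean`, p250278; W-level descent p252147 / p252492) types the INTEGRAL
containment `ι g = ι h · (ϖ B)`, `h ∈ Λ`, on the `χ_K`-eigen `Λ`-dual datum of `E♭ = V` over
`ℚ(μ_{p^∞})` (all three semistable types); THIS node is the RATIONAL (`Λ ⊗ ℚ_p`: `p`-powers on both
sides) containment on the `Λ`-dual datum of the ADDITIVE `W` over `ℚ_∞`, and it carries the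
boundedness of `ϖ B` (`∃ G ∈ Λ, ι G = p^n ϖ B`) inside — integral ⟹ rational given eigen-descent and
boundedness; rational + ONE unit coefficient + Kato's half ⟹ the gen-1 equality (§2) ⟹ p10's integral
containment (`RatMainConjLowerBridges.lean`). Same located gap, two currencies; ONE notion per
currency. OPEN — OUR typed missing input (`@[conjecture]`); nothing asserted.
[cite: SkinnerUrban2014, Cor. 3.6.2 (p. 42) (shape only; nothing asserted)]
[cite: MazurTateTeitelbaum1986Invent, §I.10, §I.13 (shape only; nothing asserted)] -/
@[conjecture] def ChiBranchRatLowerDvdMultAt (W : WeierstrassCurve ℚ) (p : ℕ) [Fact p.Prime] : Prop :=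
  ∀ (V : WeierstrassCurve ℚ) [V.IsElliptic] [V.IsGloballyMinimal]
    {κ : ZpExtension ℚ p} {γ : Field.absoluteGaloisGroup ℚ} {N : ℕ} [NeZero N]
    {f : CuspForm (Gamma0 N) 2},
    p % 4 = 1 →
    (∃ C : VariableChange ℚ, C • V.quadraticTwist (p : ℚ) = W) →
    Mult V p →
    κ.IsCyclotomic → κ.IsTopGenerator γ → IsCyclotomicVariable p γ → IsNewformOf V f →
    ∀ (ap : ℤ), cuspCoeff f p = ap →
    ∀ (D : W.SelmerDualData κ γ) (ϖ : ℚ), (ϖ : ℝ) * V.realPeriodRat = plusPeriod f →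
      ∀ g ∈ D.charIdeal, ∃ (G : IwasawaAlgebra p) (m n : ℕ),
        PowerSeries.C ((p : ℤ_[p]) ^ m) * g ∈ Ideal.span {G} ∧
        iwasawaToPowerSeries p G =
          PowerSeries.C ((p : ℚ_[p]) ^ n) *
            (PowerSeries.C (ϖ : ℚ_[p]) * padicLFunctionPlusBranchMult f (ap : ℚ_[p]) (p / 2))

/-- Unfolding lemma for `ChiBranchRatLowerDvdMultAt` (to apply the predicate as a function). -/
theorem chiBranchRatLowerDvdMultAt_iff (W : WeierstrassCurve ℚ) (p : ℕ) [Fact p.Prime] :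
    ChiBranchRatLowerDvdMultAt W p ↔
      ∀ (V : WeierstrassCurve ℚ) [V.IsElliptic] [V.IsGloballyMinimal]
        {κ : ZpExtension ℚ p} {γ : Field.absoluteGaloisGroup ℚ} {N : ℕ} [NeZero N]
        {f : CuspForm (Gamma0 N) 2},
        p % 4 = 1 →
        (∃ C : VariableChange ℚ, C • V.quadraticTwist (p : ℚ) = W) →
        Mult V p →
        κ.IsCyclotomic → κ.IsTopGenerator γ → IsCyclotomicVariable p γ → IsNewformOf V f →
        ∀ (ap : ℤ), cuspCoeff f p = ap →
        ∀ (D : W.SelmerDualData κ γ) (ϖ : ℚ), (ϖ : ℝ) * V.realPeriodRat = plusPeriod f →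
          ∀ g ∈ D.charIdeal, ∃ (G : IwasawaAlgebra p) (m n : ℕ),
            PowerSeries.C ((p : ℤ_[p]) ^ m) * g ∈ Ideal.span {G} ∧
            iwasawaToPowerSeries p G =
              PowerSeries.C ((p : ℚ_[p]) ^ n) *
                (PowerSeries.C (ϖ : ℚ_[p]) * padicLFunctionPlusBranchMult f (ap : ℚ_[p]) (p / 2)) :=
  Iff.rfl

/-- **The rational EQUALITY implies the one-sided rational containment** (trivial direction).
[cite: SkinnerUrban2014, Thm. 3.6.4 (p. 43) (shape only)] -/
theorem chiBranchRatLowerDvdMultAt_of_ratCharEqMult (W : WeierstrassCurve ℚ) (p : ℕ)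
    [hp : Fact p.Prime] (h : ChiBranchRatCharEqMultAt W p) : ChiBranchRatLowerDvdMultAt W p := by
  intro V _ _ κ γ N _ f hp1 hCW hV hκ hγ hcv hf ap hap D ϖ hϖ g hg
  obtain ⟨-, g₀, k, hchar, hι⟩ := h V hp1 hCW hV hκ hγ hcv hf ap hap D ϖ hϖ
  have hp0 : (p : ℚ_[p]) ≠ 0 := Nat.cast_ne_zero.mpr hp.out.ne_zero
  rw [hchar] at hg
  obtain ⟨s, rfl⟩ := Ideal.mem_span_singleton'.mp hg
  rcases le_or_gt 0 k with hk | hk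
  · obtain ⟨n, rfl⟩ : ∃ n : ℕ, k = n := ⟨k.toNat, (Int.toNat_of_nonneg hk).symm⟩
    refine ⟨g₀, 0, n, ?_, ?_⟩
    · rw [pow_zero, map_one, one_mul]
      exact Ideal.mem_span_singleton'.mpr ⟨s, rfl⟩
    · rw [hι, zpow_natCast, map_mul, mul_assoc]
  · obtain ⟨m, hm⟩ : ∃ m : ℕ, -k = m := ⟨(-k).toNat, (Int.toNat_of_nonneg (by omega)).symm⟩
    refine ⟨PowerSeries.C ((p : ℤ_[p]) ^ m) * g₀, m, 0, ?_, ?_⟩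
    · exact Ideal.mem_span_singleton'.mpr ⟨s, by ring⟩
    · rw [map_mul, hι, iwasawaToPowerSeries_C_natCast_pow, pow_zero, map_one, one_mul, ← mul_assoc,
        ← map_mul, ← mul_assoc, ← zpow_natCast, ← hm, ← zpow_add₀ hp0, neg_add_cancel, zpow_zero,
        one_mul]

/-! ### §1 Kato's half on `X(E/ℚ_∞)` for the multiplicative twist, even branch — the full series
(the half-tail core `isTorsion_and_exists_map_eq_of_halfTail` is the (M)-odd file's, imported) -/

section KatoHalf

variable (W : WeierstrassCurve ℚ) [W.IsElliptic] (p : ℕ) [hp : Fact p.Prime]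

/-- **Kato's half of the even-branch main conjecture of the MULTIPLICATIVE twist, on `X(E/ℚ_∞)`, as a
power series identity.** For `W/ℚ` potentially multiplicative at `p ≡ 1 (mod 4)` (`PotMult W p`), every
globally minimal `V` with `C • V^{(p)} = W` (then `V` is multiplicative at `p`,
`PotMult.mult_of_twist_model_pStar`), `ρ_{V,p^∞}` onto at every level, newform `f` with `a_p(f) = ap`,
cyclotomic `κ/γ`, `Λ`-dual datum `D` of `Sel_{p^∞}(W/ℚ_∞)` and `ϖ·Ω_V = Ω⁺_f`: `X(W/ℚ_∞)` is
`Λ`-torsion and some `g ∈ char_Λ X(W/ℚ_∞)` has `ι g = u · ϖ · L_p⁺(f, ap, ω^{(p−1)/2}, T)`, `u ∈ ℤ_pˣ`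
(the multiplicative disjuncts of `hKato`: `ap = 1` split, `ap = −1` non-split).
[cite: Kato2004Asterisque, Thm. 17.4 (3) (p. 273)] [cite: Wuthrich2014, Thm. 3 (p. 383), Cor. 19 (p. 398)]
[cite: GreenbergLNM1716, §5 p. 143] [cite: MazurTateTeitelbaum1986Invent, §I.10, §I.13] -/
theorem exists_mem_charIdeal_map_eq_unit_mul_plusBranchMult_of_katoHalf
    (hKato : Wuthrich2014.kato_halfEigenCharIdeal_dvd_cyclotomicPrime_of_surjective)
    (hpm : AdditivePotMult.PotMult W p)
    (V : WeierstrassCurve ℚ) [V.IsElliptic] [V.IsGloballyMinimal]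
    {κ : ZpExtension ℚ p} {γ : Field.absoluteGaloisGroup ℚ} {N : ℕ} [NeZero N]
    {f : CuspForm (Gamma0 N) 2} (hp1 : p % 4 = 1)
    (hCW : ∃ C : VariableChange ℚ, C • V.quadraticTwist (p : ℚ) = W)
    (hsurj : ∀ n : ℕ, V.HasSurjectiveModNGaloisRep (p ^ n : ℕ))
    (hκ : κ.IsCyclotomic) (hγ : κ.IsTopGenerator γ) (hcv : IsCyclotomicVariable p γ)
    (hf : IsNewformOf V f) {ap : ℤ} (hap : cuspCoeff f p = ap) (D : W.SelmerDualData κ γ) (ϖ : ℚ)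
    (hϖ : (ϖ : ℝ) * V.realPeriodRat = plusPeriod f) :
    D.IsTorsion ∧ ∃ g ∈ D.charIdeal, ∃ u : ℤ_[p]ˣ,
      iwasawaToPowerSeries p g =
        PowerSeries.C (((u : ℤ_[p]) : ℚ_[p]) * (ϖ : ℚ_[p])) *
          padicLFunctionPlusBranchMult f (ap : ℚ_[p]) (p / 2) := by
  obtain ⟨C, hCW'⟩ := hCW
  have hp2 : p ≠ 2 := by rintro rfl; norm_num at hp1
  obtain ⟨heven, hps⟩ := even_half_of_mod_four_eq_one hp1
  have hpQ : (p : ℚ) ≠ 0 := Nat.cast_ne_zero.mpr hp.out.ne_zero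
  haveI : (V.quadraticTwist (p : ℚ)).IsElliptic := isElliptic_quadraticTwist V hpQ
  have hV : Mult V p := hpm.mult_of_twist_model_pStar hp2 V C (by rw [hps]; exact hCW')
  -- the disjunct of the fact: split (`ap = 1`) or non-split (`ap = −1`)
  have hdisj : (IsOrdinaryAt V p ∧
        padicLFunctionPlusBranchMult f (ap : ℚ_[p]) (p / 2) =
          if Even (p / 2) then padicLFunctionBranch f ((unitRoot V p : ℤ_[p]) : ℚ_[p]) (p / 2)
          else padicLFunctionMinusBranch f ((unitRoot V p : ℤ_[p]) : ℚ_[p]) (p / 2)) ∨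
      (V.HasSplitMultiplicativeReductionAtPrime p ∧
        padicLFunctionPlusBranchMult f (ap : ℚ_[p]) (p / 2) =
          if Even (p / 2) then padicLFunctionPlusBranchMult f (1 : ℚ_[p]) (p / 2)
          else padicLFunctionMinusBranchMult f (1 : ℚ_[p]) (p / 2)) ∨
      (V.HasMultiplicativeReductionAtPrime p ∧ ¬ V.HasSplitMultiplicativeReductionAtPrime p ∧
        padicLFunctionPlusBranchMult f (ap : ℚ_[p]) (p / 2) =
          if Even (p / 2) then padicLFunctionPlusBranchMult f (-1 : ℚ_[p]) (p / 2)
          else padicLFunctionMinusBranchMult f (-1 : ℚ_[p]) (p / 2)) := by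
    by_cases hs : V.HasSplitMultiplicativeReductionAtPrime p
    · obtain ⟨h1, -⟩ := hf.cuspCoeff_eq_one_and_sq_of_split hs
      obtain rfl : ap = 1 := by exact_mod_cast (hap.symm.trans h1 : ((ap : ℤ) : ℂ) = 1)
      refine Or.inr (Or.inl ⟨hs, ?_⟩)
      rw [if_pos heven, Int.cast_one]
    · obtain ⟨h1, -⟩ := hf.cuspCoeff_eq_neg_one_and_dvd_of_nonsplit hV hs
      obtain rfl : ap = -1 := by exact_mod_cast (hap.symm.trans h1 : ((ap : ℤ) : ℂ) = -1)
      refine Or.inr (Or.inr ⟨hV, hs, ?_⟩)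
      rw [if_pos heven, Int.cast_neg, Int.cast_one]
  refine isTorsion_and_exists_map_eq_of_halfTail hCW' hp2
    (fun r hr ↦ not_sq_eq_pStar p r (by rw [hps]; exact hr)) hps hκ hγ hcv D ?_
  intro K _ _ _ F _ _ _ _ γ' h2 hθ hγ' hcyc' hγ'K hγ'F D'
  exact hKato p V K F (padicLFunctionPlusBranchMult f (ap : ℚ_[p]) (p / 2)) hp2 h2 hθ hdisj hsurj hκ
    hγ' hcyc' hγ'K hγ'F hf D' ϖ (by rw [if_pos heven]; exact hϖ)

end KatoHalf

/-! ### §2 The split: Kato's half + the typed one-sided containment = `ChiBranchRatCharEqMultAt` -/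

section Split

variable {W : WeierstrassCurve ℚ} [W.IsElliptic] {p : ℕ} [hp : Fact p.Prime]

/-- **Kato's printed half + the typed RATIONAL one-sided containment ⟹ the rational even-branch main
conjecture of the multiplicative twist, `ChiBranchRatCharEqMultAt W p`** — for `W` potentially
multiplicative at `p` with `ρ̄_{W,p^n}` onto for all `n` (transported to `V` by
`GaloisImage.hasSurjectiveModNGaloisRep_pow_iff_of_model_twist`); the two divisibilities in `Λ ⊗ ℚ_p`
give a generator `g'` with `ι g' = p^k ϖ L_p⁺` (`exists_span_eq_and_map_eq_C_zpow_mul`, the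
bookkeeping of SU Thm. 3.6.4, p. 43). [cite: SkinnerUrban2014, Thm. 3.6.4, proof (p. 43)]
[cite: Kato2004Asterisque, Thm. 17.4 (3) (p. 273)] -/
theorem chiBranchRatCharEqMultAt_of_katoHalf_of_ratLowerDvd
    (hKato : Wuthrich2014.kato_halfEigenCharIdeal_dvd_cyclotomicPrime_of_surjective)
    (hpm : AdditivePotMult.PotMult W p) (htower : ∀ n : ℕ, W.HasSurjectiveModNGaloisRep (p ^ n : ℕ))
    (hE : ChiBranchRatLowerDvdMultAt W p) : ChiBranchRatCharEqMultAt W p := by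
  intro V _ _ κ γ N _ f hp1 hCW hV hκ hγ hcv hf ap hap D ϖ hϖ
  have hpne : (p : ℚ) ≠ 0 := Nat.cast_ne_zero.mpr hp.out.ne_zero
  have hsurjV : ∀ n : ℕ, V.HasSurjectiveModNGaloisRep (p ^ n : ℕ) := fun n ↦
    (GaloisImage.hasSurjectiveModNGaloisRep_pow_iff_of_model_twist V p hpne hCW n).mp (htower n)
  obtain ⟨htor, g₁, hg₁, u, hιg₁⟩ :=
    exists_mem_charIdeal_map_eq_unit_mul_plusBranchMult_of_katoHalf W p hKato hpm V hp1 hCW hsurjV hκ hγ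
      hcv hf hap D ϖ hϖ
  obtain ⟨g, hchar, -⟩ := exists_charIdeal_eq_span_singleton p D
  obtain ⟨G, m, n, hG, hιG⟩ := hE V hp1 hCW hV hκ hγ hcv hf ap hap D ϖ hϖ g
    (by rw [hchar]; exact Ideal.mem_span_singleton_self g)
  have hg₁' : PowerSeries.C ((u⁻¹ : ℤ_[p]ˣ) : ℤ_[p]) * g₁ ∈ Ideal.span {g} := by
    rw [← hchar]; exact Ideal.mul_mem_left _ _ hg₁
  have hCu : iwasawaToPowerSeries p (PowerSeries.C ((u⁻¹ : ℤ_[p]ˣ) : ℤ_[p])) =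
      PowerSeries.C ((((u⁻¹ : ℤ_[p]ˣ) : ℤ_[p]) : ℚ_[p])) := by
    rw [PowerSeries.map_C, PadicInt.algebraMap_apply]
  have hu0 : (((u : ℤ_[p]) : ℚ_[p])) ≠ 0 := by
    intro h0
    have h1 : (((u⁻¹ : ℤ_[p]ˣ) : ℤ_[p]) : ℚ_[p]) * (((u : ℤ_[p]) : ℚ_[p])) = 1 := by
      rw [← PadicInt.coe_mul, Units.inv_mul, PadicInt.coe_one]
    rw [h0, mul_zero] at h1
    exact zero_ne_one h1
  have hιg₁' : iwasawaToPowerSeries p (PowerSeries.C ((u⁻¹ : ℤ_[p]ˣ) : ℤ_[p]) * g₁) =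
      PowerSeries.C ((p : ℚ_[p]) ^ (0 : ℕ)) *
        (PowerSeries.C (ϖ : ℚ_[p]) * padicLFunctionPlusBranchMult f (ap : ℚ_[p]) (p / 2)) := by
    rw [pow_zero, map_one, one_mul, map_mul, hιg₁, hCu, ← mul_assoc, ← map_mul, coe_units_inv_eq_inv,
      ← mul_assoc, inv_mul_cancel₀ hu0, one_mul]
  obtain ⟨g', k, hspan, hιg'⟩ := exists_span_eq_and_map_eq_C_zpow_mul p hg₁' hιg₁' hG hιG
  refine ⟨htor, g', k, hchar.trans hspan, ?_⟩
  rw [hιg', map_mul, mul_assoc]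

/-- **X4(M) ∧ surj(p), `p ≡ 1 (mod 4)`: the rational even-branch main conjecture of the multiplicative
twist from its Skinner half** — tower from surj(p) with NO certificate on (M) (n1011-p14
`ClassX4M.towerSurj_of_surj`, every odd `p`). [cite: Kato2004Asterisque, Thm. 17.4 (3) (p. 273)] [cite: Wuthrich2014, Lemma 20 (p. 399)]
[cite: SkinnerUrban2014, Thm. 3.6.4, proof (p. 43)] -/
theorem _root_.Summit.BirchSwinnertonDyer.Rank1Residual.AdditivePotMult.ClassX4M.chiBranchRatCharEqMultAt_of_ratLowerDvd_of_surj
    (hKato : Wuthrich2014.kato_halfEigenCharIdeal_dvd_cyclotomicPrime_of_surjective)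
    (hX : AdditivePotMult.ClassX4M W p) (hsurj : Surj W p) (hE : ChiBranchRatLowerDvdMultAt W p) :
    ChiBranchRatCharEqMultAt W p :=
  chiBranchRatCharEqMultAt_of_katoHalf_of_ratLowerDvd hKato hX.potMult (hX.towerSurj_of_surj hsurj) hE

end Split

/-! ### §3 X4(M) ∧ surj(p): ends over `ChiBranchRatLowerDvdMultAt W p` + ONE unit coefficient -/

section Ends

variable {W : WeierstrassCurve ℚ} [W.IsElliptic] [W.IsGloballyMinimal] {p : ℕ} [hp : Fact p.Prime]

/-- **X4(M) ∧ surj(p), `r_an = 0`, `p ≡ 1 (mod 4)`: the LOWER half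
`ord_p #Ш_an ≤ ord_p #Ш` ⟸ the one-sided rational containment on the even branch of the multiplicative
twist (`ChiBranchRatLowerDvdMultAt W p`) + ONE unit coefficient (`MultBranchUnitCoeffCert`)** (+ Kato's
half `hKato`, Delbourgo 1998 Prop. 4 exact (M) `hDelX`, Pal `hPal`, GZK, modularity; p251062's
`ClassX4M.missingLowerBoundAt_rankZero_of_ratCharEqMult_of_unitCoeff`). X4(M) stays CONSTRUCTION-SHAPED.
[cite: SkinnerUrban2014, Cor. 3.6.2 (p. 42) (shape only)] [cite: Kato2004Asterisque, Thm. 17.4 (3) (p. 273)]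
[cite: Delbourgo1998, Prop. 4 (p. 144), §2.2 Lemma (ii) (p. 139)] [cite: Miller2011LMS, Def. 1.1] -/
theorem _root_.Summit.BirchSwinnertonDyer.Rank1Residual.AdditivePotMult.ClassX4M.missingLowerBoundAt_rankZero_of_ratLowerDvdMult_of_unitCoeff_of_surj
    (hKato : Wuthrich2014.kato_halfEigenCharIdeal_dvd_cyclotomicPrime_of_surjective)
    (hDelX : Delbourgo1998.prop4_rankZero_constantCoeff_eq_unit_mul_of_potMult)
    (hPal : Pal2012.thm32_sqrt_mul_realPeriodRat_twist_eq_of_prime_one_mod_four)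
    (hGZK : rank_eq_analyticRank_of_analyticRank_le_one) (hmod : hasEntireLFunction_rat)
    (hmodD : nonempty_modularParametrizationData)
    (hX : AdditivePotMult.ClassX4M W p) (hp4 : p % 4 = 1) (hr : W.analyticRank = 0) (hsurj : Surj W p)
    (hE : ChiBranchRatLowerDvdMultAt W p) (hcert : MultBranchUnitCoeffCert W p) :
    MissingLowerBoundAt W p :=
  hX.missingLowerBoundAt_rankZero_of_ratCharEqMult_of_unitCoeff hDelX hPal hGZK hmod hmodD hp4 hr
    (hX.chiBranchRatCharEqMultAt_of_ratLowerDvd_of_surj hKato hsurj hE) hcert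

/-- **X4(M) ∧ surj(p), `r_an = 0`, `p ≡ 1 (mod 4)`: `BSD(E,p)` ⟸ the ONE-SIDED rational containment
on the even branch of the multiplicative twist (`ChiBranchRatLowerDvdMultAt W p`, typed — the located
gap in its native `Λ ⊗ ℚ_p` currency) + ONE unit coefficient, and NOTHING ELSE typed**: Kato's half
`hKato` serves both the upgrade (§2) and the UPPER half (additive-p1's `ClassX4M.bsdp_rankZero_of_surj_of_lower`
inside p251062; its `hL20` binder is discharged by the tree's PROOF of Wuthrich's Lemma 20).
Nothing booked; X4(M) stays CONSTRUCTION-SHAPED. [cite: SkinnerUrban2014, Cor. 3.6.2 (p. 42) (shape only)]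
[cite: Kato2004Asterisque, Thm. 17.4 (3) (p. 273)] [cite: Delbourgo1998, Prop. 4 (p. 144)]
[cite: Wuthrich2014, Lemma 20 (p. 399)] [cite: Miller2011LMS, §1 and Def. 1.1] -/
theorem _root_.Summit.BirchSwinnertonDyer.Rank1Residual.AdditivePotMult.ClassX4M.bsdp_rankZero_of_ratLowerDvdMult_of_unitCoeff_of_surj
    (hKato : Wuthrich2014.kato_halfEigenCharIdeal_dvd_cyclotomicPrime_of_surjective)
    (hDelX : Delbourgo1998.prop4_rankZero_constantCoeff_eq_unit_mul_of_potMult)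
    (hDel : Delbourgo1998.prop4_rankZero_pow_dvd_constantCoeff)
    (hPal : Pal2012.thm32_sqrt_mul_realPeriodRat_twist_eq_of_prime_one_mod_four)
    (hGZK : rank_eq_analyticRank_of_analyticRank_le_one) (hmod : hasEntireLFunction_rat)
    (hmodD : nonempty_modularParametrizationData)
    (hX : AdditivePotMult.ClassX4M W p) (hp4 : p % 4 = 1) (hr : W.analyticRank = 0) (hsurj : Surj W p)
    (hE : ChiBranchRatLowerDvdMultAt W p) (hcert : MultBranchUnitCoeffCert W p) : BSDp W p :=
  hX.bsdp_rankZero_of_ratCharEqMult_of_unitCoeff_of_surj hDelX hDel hPal hGZK hmod hmodD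
    Wuthrich2014.lemma20_surjective_threeAdic_of_semistable_holds hKato hp4 hr hsurj
    (hX.chiBranchRatCharEqMultAt_of_ratLowerDvd_of_surj hKato hsurj hE) hcert

/-- **X4(M) ∧ surj(p), `r_an = 0`, `p ≡ 1 (mod 4)`, Q6 PASS record of index `n₀`
(census-ctyper1's `CensusQ6.MultFirstUnitIndexAt W p n₀`): `BSD(E,p)`** ⟸ record (EVIDENCE) +
`ChiBranchRatLowerDvdMultAt W p` (TYPED) + printed facts — the per-row theorem for the register's
(M)@5 / (M)@13 / (M)@17 … rows. Nothing booked. [cite: MazurTateTeitelbaum1986Invent, §I.13]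
[cite: Kato2004Asterisque, Thm. 17.4 (3) (p. 273)] [cite: Delbourgo1998, Prop. 4 (p. 144)]
[cite: Pal2012, Thm. 3.2] [cite: Miller2011LMS, Def. 1.1] -/
theorem _root_.Summit.BirchSwinnertonDyer.Rank1Residual.AdditivePotMult.ClassX4M.bsdp_rankZero_of_ratLowerDvdMult_of_firstUnitIndex_of_surj
    (hKato : Wuthrich2014.kato_halfEigenCharIdeal_dvd_cyclotomicPrime_of_surjective)
    (hDelX : Delbourgo1998.prop4_rankZero_constantCoeff_eq_unit_mul_of_potMult)
    (hDel : Delbourgo1998.prop4_rankZero_pow_dvd_constantCoeff)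
    (hPal : Pal2012.thm32_sqrt_mul_realPeriodRat_twist_eq_of_prime_one_mod_four)
    (hGZK : rank_eq_analyticRank_of_analyticRank_le_one) (hmod : hasEntireLFunction_rat)
    (hmodD : nonempty_modularParametrizationData)
    (hX : AdditivePotMult.ClassX4M W p) (hp4 : p % 4 = 1) (hr : W.analyticRank = 0) (hsurj : Surj W p)
    (hE : ChiBranchRatLowerDvdMultAt W p) {n₀ : ℕ} (hrec : CensusQ6.MultFirstUnitIndexAt W p n₀) :
    BSDp W p :=
  hX.bsdp_rankZero_of_ratLowerDvdMult_of_unitCoeff_of_surj hKato hDelX hDel hPal hGZK hmod hmodD hp4 hr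
    hsurj hE (CensusQ6.multBranchUnitCoeffCert_of_firstUnitIndex hrec)

end Ends

end Summit.BirchSwinnertonDyer.Rank1Residual.Additive

end
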